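import Summits.CriticalPhenomena.PercolationContinuityZ3.Theorems.PercNearOneGluingNoHeavyLowerTailIncStarKeyUnreachable
import Summits.CriticalPhenomena.PercolationContinuityZ3.Theorems.PercNearOneGluingNoHeavyLowerTailIncStarStrongInduction
import HarnessLib

/-!
# The increasing star from CHORD-CONCAVITY of the root–unmarked KEY along the other root edges

Support file for the Sahi programme (`--supports stmt-CriticalPhenomena-4575`, prover prim-sahi-p2 gen 6).  No definitions, no named facts,
no sorries; standard axioms.  Memo: `run/shared/lean/prim/prim-sahi/FROM-prim-sahi-p2-gen6-KEY-FIBRE-CHORD.md`, `prim-sahi-p2/PROOF-E3.md` §17.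

Write `K'(w) = key P_{w[e↦1]} P_{w[e↦0]} ({s↔b},{s↔c},{s↔y})` for the open-end KEY of the increasing star at the root–unmarked pair
`e = s(s,z)` (`K' = 3B₂ − 2B₃`; `IncStar.incStar_nonneg_of_rootUnmarkedKey`: `K' ≥ 0` at every such pair gives the star on all graphs).
Along another pair `f = s(u,v) ≠ e` whose end `u` is surely joined to `s` (a path of weight-`1` pairs, `e` excluded), `a = w f ↦ K'` is a cubic;
the census (memo §3: ≈ 1 200 such pairs incl. adversarial climbs on `n ≤ 10`, exact rechecks) finds it ABOVE ITS CHORD,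
`K'(w) ≥ (1 − w f)·K'(w[f↦0]) + (w f)·K'(w[f↦1])` — while this fails along pairs away from the root.

* `rootKey_nonneg_of_closedComponent` — if no fractional pair other than `e` leaves the weight-`1` component of `s`, then `K'(w) ≥ 0`:
  either some target lies outside the component (then it is `P_{w[e↦0]}`-unreachable and `rootEdge_key_nonneg_of_unreachable` applies) or all
  three hub connections are almost sure under both laws and `K' = 0`.
* `rootKey_nonneg_of_chord` — the chord hypothesis along such pairs `f` (stated with the full induction hypothesis of the star available) implies
  `K'(w) ≥ 0` for every weight, by induction on the number of fractional non-loop pairs other than `e` (a point above a chord with nonnegative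
  ends is nonnegative).
* `incStar_nonneg_of_rootKeyChord` — hence the increasing star `E₃({s↔b},{s↔c},{s↔y}) ≥ 0` on every finite weighted graph on `Fin n`
  follows from that ONE chord inequality (via `incStar_nonneg_of_rootUnmarkedBernsteinStrongIH` and the open-end KEY lemmas of
  `…FrontierDecRowsUnmarkedEdgeKeyOpen`).  In closed form the chord inequality is the cubic `(KC)` of the memo (three hubs `s, v, z`; it is the
  single remaining hypothesis).
-/

noncomputable section

namespace Summit.CriticalPhenomena.PercolationContinuityZ3.Theorems

namespace IncStar

open MeasureTheory Literature.Probability.Percolation Literature.Probability.LatticeModels EdgeInduction TerminalEdgeInduction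
open scoped Classical

variable {n : ℕ}

/-! ### Almost-sure hub connections inside the weight-1 component -/

/-- A weight-`1` path from `s` to `t` makes `{s↔t}` (and any intersection of such events containing the a.s. set) almost sure:
if `S ⊇ {ω | every weight-1 pair is open}` then `P_w(S) = 1`. [folklore] -/
theorem real_eq_one_of_sureOpen_subset (w : Sym2 (Fin n) → unitInterval) {S : Set (BondConfig (Fin n))}
    (hS : {ω : BondConfig (Fin n) | ∀ e, w e = 1 → e ∈ ω} ⊆ S) : (prodBernoulli w).real S = 1 :=
  le_antisymm measureReal_le_one ((real_sureOpen w).symm.le.trans (measureReal_mono hS))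

/-- On a configuration in which every weight-`1` pair is open, weight-`1` reachability implies open reachability. [folklore] -/
theorem mem_openConn_of_sureReachable (w : Sym2 (Fin n) → unitInterval) {s t : Fin n}
    (h : (SimpleGraph.fromEdgeSet {e : Sym2 (Fin n) | w e = 1}).Reachable s t)
    {ω : BondConfig (Fin n)} (hω : ∀ e, w e = 1 → e ∈ ω) : ω ∈ openConn s t := by
  have hle : SimpleGraph.fromEdgeSet {e : Sym2 (Fin n) | w e = 1} ≤ openGraph ω := by
    intro u v huv
    rw [SimpleGraph.fromEdgeSet_adj] at huv
    rw [openGraph_adj]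
    exact ⟨hω _ huv.1, huv.2⟩
  exact h.mono hle

/-- Weight-`1` reachability is monotone under raising one weight to `1`. [folklore] -/
theorem sureReachable_mono_update_one (w : Sym2 (Fin n) → unitInterval) (e : Sym2 (Fin n)) {s t : Fin n}
    (h : (SimpleGraph.fromEdgeSet {f : Sym2 (Fin n) | Function.update w e 0 f = 1}).Reachable s t) :
    (SimpleGraph.fromEdgeSet {f : Sym2 (Fin n) | Function.update w e 1 f = 1}).Reachable s t := by
  refine h.mono (SimpleGraph.fromEdgeSet_mono ?_)
  intro f hf
  simp only [Set.mem_setOf_eq] at hf ⊢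
  by_cases hfe : f = e
  · subst hfe; simp
  · rw [Function.update_of_ne hfe] at hf ⊢; exact hf

/-- **`K' ≥ 0` when the weight-1 component of the root is closed.**  If every non-loop pair other than `e = s(s,z)` that leaves the
weight-`1` component of `s` (computed with `e` closed) is non-fractional, then `K'(w) ≥ 0`. [this work] -/
theorem rootKey_nonneg_of_closedComponent (w : Sym2 (Fin n) → unitInterval) (s b c y z : Fin n)
    (hnone : ∀ u v : Fin n, (SimpleGraph.fromEdgeSet {f : Sym2 (Fin n) | Function.update w s(s, z) 0 f = 1}).Reachable s u →
      u ≠ v → s(u, v) ≠ s(s, z) → s(u, v) ∉ fracEdges w) :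
    0 ≤ key (prodBernoulli (Function.update w s(s, z) 1)) (prodBernoulli (Function.update w s(s, z) 0))
          (openConn s b) (openConn s c) (openConn s y) := by
  set e : Sym2 (Fin n) := s(s, z) with he
  set w0 := Function.update w e 0 with hw0
  set w1 := Function.update w e 1 with hw1
  set G1 := SimpleGraph.fromEdgeSet {f : Sym2 (Fin n) | w0 f = 1} with hG1
  -- the weight-1 component of `s` under `w0` is closed
  have hcl : ∀ u v : Fin n, G1.Reachable s u → ¬ G1.Reachable s v → u ≠ v → w0 s(u, v) = 0 := by
    intro u v hu hv huv
    by_cases hfe : s(u, v) = e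
    · rw [hfe, hw0]; simp
    have hwf : w0 s(u, v) = w s(u, v) := by rw [hw0, Function.update_of_ne hfe]
    rcases eq_zero_or_one_of_not_mem_fracEdges (hnone u v hu huv hfe) with h0 | h1
    · rw [hwf, h0]
    · exfalso
      apply hv
      refine hu.trans (SimpleGraph.Adj.reachable ?_)
      rw [SimpleGraph.fromEdgeSet_adj]
      exact ⟨by show w0 s(u, v) = 1; rw [hwf, h1], huv⟩
  by_cases hall : G1.Reachable s b ∧ G1.Reachable s c ∧ G1.Reachable s y
  · -- all three hub connections are almost sure under both laws: K' = 0
    obtain ⟨hb, hc, hy⟩ := hall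
    have one0 : ∀ S : Set (BondConfig (Fin n)), {ω : BondConfig (Fin n) | ∀ f, w0 f = 1 → f ∈ ω} ⊆ S →
        (prodBernoulli w0).real S = 1 := fun S hS => real_eq_one_of_sureOpen_subset w0 hS
    have one1 : ∀ S : Set (BondConfig (Fin n)), {ω : BondConfig (Fin n) | ∀ f, w1 f = 1 → f ∈ ω} ⊆ S →
        (prodBernoulli w1).real S = 1 := fun S hS => real_eq_one_of_sureOpen_subset w1 hS
    have m0 : ∀ t, G1.Reachable s t → ∀ ω : BondConfig (Fin n), (∀ f, w0 f = 1 → f ∈ ω) → ω ∈ openConn s t :=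
      fun t ht ω hω => mem_openConn_of_sureReachable w0 ht hω
    have m1 : ∀ t, G1.Reachable s t → ∀ ω : BondConfig (Fin n), (∀ f, w1 f = 1 → f ∈ ω) → ω ∈ openConn s t :=
      fun t ht ω hω => mem_openConn_of_sureReachable w1 (sureReachable_mono_update_one w e ht) hω
    have a0 : (prodBernoulli w0).real (openConn s b) = 1 := one0 _ fun ω hω => m0 b hb ω hω
    have b0 : (prodBernoulli w0).real (openConn s c) = 1 := one0 _ fun ω hω => m0 c hc ω hω
    have c0 : (prodBernoulli w0).real (openConn s y) = 1 := one0 _ fun ω hω => m0 y hy ω hω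
    have ab0 : (prodBernoulli w0).real (openConn s b ∩ openConn s c) = 1 :=
      one0 _ fun ω hω => ⟨m0 b hb ω hω, m0 c hc ω hω⟩
    have ac0 : (prodBernoulli w0).real (openConn s b ∩ openConn s y) = 1 :=
      one0 _ fun ω hω => ⟨m0 b hb ω hω, m0 y hy ω hω⟩
    have bc0 : (prodBernoulli w0).real (openConn s c ∩ openConn s y) = 1 :=
      one0 _ fun ω hω => ⟨m0 c hc ω hω, m0 y hy ω hω⟩
    have abc0 : (prodBernoulli w0).real (openConn s b ∩ openConn s c ∩ openConn s y) = 1 :=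
      one0 _ fun ω hω => ⟨⟨m0 b hb ω hω, m0 c hc ω hω⟩, m0 y hy ω hω⟩
    have a1 : (prodBernoulli w1).real (openConn s b) = 1 := one1 _ fun ω hω => m1 b hb ω hω
    have b1 : (prodBernoulli w1).real (openConn s c) = 1 := one1 _ fun ω hω => m1 c hc ω hω
    have c1 : (prodBernoulli w1).real (openConn s y) = 1 := one1 _ fun ω hω => m1 y hy ω hω
    have ab1 : (prodBernoulli w1).real (openConn s b ∩ openConn s c) = 1 :=
      one1 _ fun ω hω => ⟨m1 b hb ω hω, m1 c hc ω hω⟩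
    have ac1 : (prodBernoulli w1).real (openConn s b ∩ openConn s y) = 1 :=
      one1 _ fun ω hω => ⟨m1 b hb ω hω, m1 y hy ω hω⟩
    have bc1 : (prodBernoulli w1).real (openConn s c ∩ openConn s y) = 1 :=
      one1 _ fun ω hω => ⟨m1 c hc ω hω, m1 y hy ω hω⟩
    rw [key_eq, a0, b0, c0, ab0, ac0, bc0, abc0, a1, b1, c1, ab1, ac1, bc1]
    norm_num
  · -- some target is unreachable from `s` with `e` closed: `rootEdge_key_nonneg_of_unreachable`
    have hG : (prodBernoulli w0).real ({ω | ∀ f, w0 f = 1 → f ∈ ω} ∩ {ω | ∀ f, w0 f = 0 → f ∉ ω}) = 1 := real_sureSet w0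
    have zero_of : ∀ t, ¬ G1.Reachable s t → (prodBernoulli w0).real (openConn s t) = 0 := by
      intro t ht
      rw [real_eq_real_inter_of_real_eq_one MeasurableSet.of_discrete hG (openConn s t)]
      have hempty : openConn s t ∩ ({ω | ∀ f, w0 f = 1 → f ∈ ω} ∩ {ω | ∀ f, w0 f = 0 → f ∉ ω}) = ∅ := by
        ext ω
        simp only [Set.mem_inter_iff, Set.mem_setOf_eq, Set.mem_empty_iff_false, iff_false, not_and]
        intro hω h1 h0
        exact ht ((openConn_iff_sureReachable_of_closed w0 s hcl h1 h0 t).1 hω)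
      rw [hempty]; simp
    push Not at hall
    by_cases hb : G1.Reachable s b
    · by_cases hc : G1.Reachable s c
      · exact rootEdge_key_nonneg_of_unreachable w s b c y z (Or.inr (Or.inr (zero_of y (hall hb hc))))
      · exact rootEdge_key_nonneg_of_unreachable w s b c y z (Or.inr (Or.inl (zero_of c hc)))
    · exact rootEdge_key_nonneg_of_unreachable w s b c y z (Or.inl (zero_of b hb))

/-- Setting a weight to `0` or `1` at a fractional non-loop pair `f ≠ e` strictly decreases the number of fractional non-loop pairs other
than `e`. [folklore] -/
theorem card_fracEdges_ne_update_lt (w : Sym2 (Fin n) → unitInterval) {e f : Sym2 (Fin n)} (hf : f ∈ fracEdges w)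
    (hnd : ¬ f.IsDiag) (hfe : f ≠ e) (u : unitInterval) (hu : u = 0 ∨ u = 1) :
    ((fracEdges (Function.update w f u)).filter fun g => ¬ g.IsDiag ∧ g ≠ e).card <
      ((fracEdges w).filter fun g => ¬ g.IsDiag ∧ g ≠ e).card := by
  have hmemf : f ∈ (fracEdges w).filter fun g => ¬ g.IsDiag ∧ g ≠ e := Finset.mem_filter.2 ⟨hf, hnd, hfe⟩
  have hsub : ((fracEdges (Function.update w f u)).filter fun g => ¬ g.IsDiag ∧ g ≠ e) ⊆
      ((fracEdges w).filter fun g => ¬ g.IsDiag ∧ g ≠ e).erase f := by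
    intro g hg
    rw [Finset.mem_filter] at hg
    have hg' := fracEdges_update_subset w f u hu hg.1
    rw [Finset.mem_erase] at hg' ⊢
    exact ⟨hg'.1, Finset.mem_filter.2 ⟨hg'.2, hg.2⟩⟩
  have h1 := Finset.card_le_card hsub
  rw [Finset.card_erase_of_mem hmemf] at h1
  have hpos := Finset.card_pos.2 ⟨_, hmemf⟩
  omega

/-- Setting a weight to `0` or `1` does not increase the number of fractional non-loop pairs. [folklore] -/
theorem card_fracEdges_update_le (w : Sym2 (Fin n) → unitInterval) (f : Sym2 (Fin n)) (u : unitInterval) (hu : u = 0 ∨ u = 1) :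
    ((fracEdges (Function.update w f u)).filter fun g => ¬ g.IsDiag).card ≤ ((fracEdges w).filter fun g => ¬ g.IsDiag).card := by
  refine Finset.card_le_card fun g hg => ?_
  rw [Finset.mem_filter] at hg ⊢
  exact ⟨(Finset.mem_erase.1 (fracEdges_update_subset w f u hu hg.1)).2, hg.2⟩

/-- **`K' ≥ 0` from chord-concavity along the other root edges.**  If, for every weight and marking and every fractional non-loop pair
`f = s(u,v) ≠ e` with `u` in the weight-1 component of `s` (the star being available for all weights with fewer fractional non-loop pairs),
`K'(w) ≥ (1 − w f)·K'(w[f↦0]) + (w f)·K'(w[f↦1])`, then `K'(w) ≥ 0` for every weight `w` carrying that induction hypothesis. [this work] -/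
theorem rootKey_nonneg_of_chord
    (hKC : ∀ (w : Sym2 (Fin n) → unitInterval) (s b c y z u v : Fin n), z ≠ s → z ≠ b → z ≠ c → z ≠ y →
      u ≠ v → s(u, v) ≠ s(s, z) → s(u, v) ∈ fracEdges w →
      (SimpleGraph.fromEdgeSet {f : Sym2 (Fin n) | Function.update w s(s, z) 0 f = 1}).Reachable s u →
      (∀ w' : Sym2 (Fin n) → unitInterval,
          ((fracEdges w').filter fun f => ¬ f.IsDiag).card < ((fracEdges w).filter fun f => ¬ f.IsDiag).card →
          ∀ s' b' c' y' : Fin n, 0 ≤ sahiE3 (prodBernoulli w') (openConn s' b') (openConn s' c') (openConn s' y')) →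
      (1 - (w s(u, v) : ℝ)) *
          key (prodBernoulli (Function.update (Function.update w s(u, v) 0) s(s, z) 1))
              (prodBernoulli (Function.update (Function.update w s(u, v) 0) s(s, z) 0)) (openConn s b) (openConn s c) (openConn s y)
        + (w s(u, v) : ℝ) *
          key (prodBernoulli (Function.update (Function.update w s(u, v) 1) s(s, z) 1))
              (prodBernoulli (Function.update (Function.update w s(u, v) 1) s(s, z) 0)) (openConn s b) (openConn s c) (openConn s y)
      ≤ key (prodBernoulli (Function.update w s(s, z) 1)) (prodBernoulli (Function.update w s(s, z) 0))
          (openConn s b) (openConn s c) (openConn s y)) :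
    ∀ (k : ℕ) (w : Sym2 (Fin n) → unitInterval) (s b c y z : Fin n), z ≠ s → z ≠ b → z ≠ c → z ≠ y →
      ((fracEdges w).filter fun g => ¬ g.IsDiag ∧ g ≠ s(s, z)).card ≤ k →
      (∀ w' : Sym2 (Fin n) → unitInterval,
          ((fracEdges w').filter fun f => ¬ f.IsDiag).card < ((fracEdges w).filter fun f => ¬ f.IsDiag).card →
          ∀ s' b' c' y' : Fin n, 0 ≤ sahiE3 (prodBernoulli w') (openConn s' b') (openConn s' c') (openConn s' y')) →
      0 ≤ key (prodBernoulli (Function.update w s(s, z) 1)) (prodBernoulli (Function.update w s(s, z) 0))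
            (openConn s b) (openConn s c) (openConn s y) := by
  intro k
  induction k with
  | zero =>
      intro w s b c y z _ _ _ _ hk _
      refine rootKey_nonneg_of_closedComponent w s b c y z fun u v _ huv hfe hmem => ?_
      have : s(u, v) ∈ (fracEdges w).filter fun g => ¬ g.IsDiag ∧ g ≠ s(s, z) :=
        Finset.mem_filter.2 ⟨hmem, by rwa [Sym2.mk_isDiag_iff], hfe⟩
      have := Finset.card_pos.2 ⟨_, this⟩
      omega
  | succ k ih =>
      intro w s b c y z hzs hzb hzc hzy hk IH
      by_cases hex : ∃ u v : Fin n, (SimpleGraph.fromEdgeSet {f : Sym2 (Fin n) | Function.update w s(s, z) 0 f = 1}).Reachable s u ∧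
          u ≠ v ∧ s(u, v) ≠ s(s, z) ∧ s(u, v) ∈ fracEdges w
      · obtain ⟨u, v, hu, huv, hfe, hmem⟩ := hex
        set f : Sym2 (Fin n) := s(u, v) with hfdef
        have hnd : ¬ f.IsDiag := by rw [hfdef, Sym2.mk_isDiag_iff]; exact huv
        have hchord := hKC w s b c y z u v hzs hzb hzc hzy huv hfe hmem hu IH
        -- the two ends have fewer fractional pairs other than `e`, and inherit the induction hypothesis of the star
        have hk0 : ((fracEdges (Function.update w f 0)).filter fun g => ¬ g.IsDiag ∧ g ≠ s(s, z)).card ≤ k := by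
          have := card_fracEdges_ne_update_lt w hmem hnd hfe 0 (Or.inl rfl); omega
        have hk1 : ((fracEdges (Function.update w f 1)).filter fun g => ¬ g.IsDiag ∧ g ≠ s(s, z)).card ≤ k := by
          have := card_fracEdges_ne_update_lt w hmem hnd hfe 1 (Or.inr rfl); omega
        have IH0 : ∀ w' : Sym2 (Fin n) → unitInterval,
            ((fracEdges w').filter fun f => ¬ f.IsDiag).card < ((fracEdges (Function.update w f 0)).filter fun f => ¬ f.IsDiag).card →
            ∀ s' b' c' y' : Fin n, 0 ≤ sahiE3 (prodBernoulli w') (openConn s' b') (openConn s' c') (openConn s' y') :=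
          fun w' hw' => IH w' (lt_of_lt_of_le hw' (card_fracEdges_update_le w f 0 (Or.inl rfl)))
        have IH1 : ∀ w' : Sym2 (Fin n) → unitInterval,
            ((fracEdges w').filter fun f => ¬ f.IsDiag).card < ((fracEdges (Function.update w f 1)).filter fun f => ¬ f.IsDiag).card →
            ∀ s' b' c' y' : Fin n, 0 ≤ sahiE3 (prodBernoulli w') (openConn s' b') (openConn s' c') (openConn s' y') :=
          fun w' hw' => IH w' (lt_of_lt_of_le hw' (card_fracEdges_update_le w f 1 (Or.inr rfl)))
        have h0 := ih (Function.update w f 0) s b c y z hzs hzb hzc hzy hk0 IH0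
        have h1 := ih (Function.update w f 1) s b c y z hzs hzb hzc hzy hk1 IH1
        have ha0 : (0 : ℝ) ≤ w f := (w f).2.1
        have ha1 : (w f : ℝ) ≤ 1 := (w f).2.2
        have hq : (0 : ℝ) ≤ 1 - w f := sub_nonneg.2 ha1
        have hsum : 0 ≤ (1 - (w f : ℝ)) *
              key (prodBernoulli (Function.update (Function.update w f 0) s(s, z) 1))
                (prodBernoulli (Function.update (Function.update w f 0) s(s, z) 0)) (openConn s b) (openConn s c) (openConn s y)
            + (w f : ℝ) *
              key (prodBernoulli (Function.update (Function.update w f 1) s(s, z) 1))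
                (prodBernoulli (Function.update (Function.update w f 1) s(s, z) 0)) (openConn s b) (openConn s c) (openConn s y) :=
          add_nonneg (mul_nonneg hq h0) (mul_nonneg ha0 h1)
        exact hsum.trans hchord
      · push Not at hex
        exact rootKey_nonneg_of_closedComponent w s b c y z fun u v hu huv hfe hmem => hex u v hu huv hfe hmem

/-- **The increasing star from chord-concavity of the root–unmarked KEY.**  If for every weight `w`, all markings `s b c y`, every
`z ∉ {s,b,c,y}` and every fractional non-loop pair `f = s(u,v) ≠ s(s,z)` whose end `u` is joined to `s` by weight-`1` pairs (with `s(s,z)` closed),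
the open-end KEY `K'(·) = key P_{·[sz↦1]} P_{·[sz↦0]}` of `({s↔b},{s↔c},{s↔y})` satisfies the chord inequality
`K'(w) ≥ (1 − w f)·K'(w[f↦0]) + (w f)·K'(w[f↦1])` — granted the increasing star for every weight with fewer fractional non-loop pairs and
every marking — then `E₃({s↔b},{s↔c},{s↔y}) ≥ 0` on every finite weighted graph on `Fin n`. [this work] -/
theorem incStar_nonneg_of_rootKeyChord
    (hKC : ∀ (w : Sym2 (Fin n) → unitInterval) (s b c y z u v : Fin n), z ≠ s → z ≠ b → z ≠ c → z ≠ y →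
      u ≠ v → s(u, v) ≠ s(s, z) → s(u, v) ∈ fracEdges w →
      (SimpleGraph.fromEdgeSet {f : Sym2 (Fin n) | Function.update w s(s, z) 0 f = 1}).Reachable s u →
      (∀ w' : Sym2 (Fin n) → unitInterval,
          ((fracEdges w').filter fun f => ¬ f.IsDiag).card < ((fracEdges w).filter fun f => ¬ f.IsDiag).card →
          ∀ s' b' c' y' : Fin n, 0 ≤ sahiE3 (prodBernoulli w') (openConn s' b') (openConn s' c') (openConn s' y')) →
      (1 - (w s(u, v) : ℝ)) *
          key (prodBernoulli (Function.update (Function.update w s(u, v) 0) s(s, z) 1))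
              (prodBernoulli (Function.update (Function.update w s(u, v) 0) s(s, z) 0)) (openConn s b) (openConn s c) (openConn s y)
        + (w s(u, v) : ℝ) *
          key (prodBernoulli (Function.update (Function.update w s(u, v) 1) s(s, z) 1))
              (prodBernoulli (Function.update (Function.update w s(u, v) 1) s(s, z) 0)) (openConn s b) (openConn s c) (openConn s y)
      ≤ key (prodBernoulli (Function.update w s(s, z) 1)) (prodBernoulli (Function.update w s(s, z) 0))
          (openConn s b) (openConn s c) (openConn s y)) :
    ∀ (w : Sym2 (Fin n) → unitInterval) (s b c y : Fin n),
      0 ≤ sahiE3 (prodBernoulli w) (openConn s b) (openConn s c) (openConn s y) := by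
  refine incStar_nonneg_of_rootUnmarkedBernsteinStrongIH ?_
  intro w s b c y z hzs hzb hzc hzy he IH
  have hnd : ¬ (s(s, z) : Sym2 (Fin n)).IsDiag := by rw [Sym2.mk_isDiag_iff]; exact hzs.symm
  have h0 : 0 ≤ sahiE3 (prodBernoulli (Function.update w s(s, z) 0)) (openConn s b) (openConn s c) (openConn s y) :=
    IH _ (card_fracEdges_update_lt w he hnd 0 (Or.inl rfl)) s b c y
  have h1 : 0 ≤ sahiE3 (prodBernoulli (Function.update w s(s, z) 1)) (openConn s b) (openConn s c) (openConn s y) :=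
    IH _ (card_fracEdges_update_lt w he hnd 1 (Or.inr rfl)) s b c y
  have hk := rootKey_nonneg_of_chord hKC _ w s b c y z hzs hzb hzc hzy le_rfl IH
  exact ⟨polar₁_nonneg_of_key_open h0 h1 hk
      (pivotal_prod_nonneg_upper w s(s, z) (isUpperSet_openConn s b) (isUpperSet_openConn s c) (isUpperSet_openConn s y)),
    polar₁_swap_nonneg_of_key_open h1 hk⟩

end IncStar

end Summit.CriticalPhenomena.PercolationContinuityZ3.Theorems
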